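import Summits.ValiantsHypothesis.ValiantsHypothesis.Theorems.LacunarySymmetroidMatrixDescartesCensusDoorA34IsotropicGauge
import Summits.ValiantsHypothesis.ValiantsHypothesis.Theorems.LacunarySymmetroidMatrixDescartesCensusDoorA34AnnihilatorDichotomy

/-!
# `MatrixDescartes` census — DOOR A at `(3,4)`: the RANK-TWO NET stratum (letters spanning a plane of matrices), ALL supports

HONEST FRAMING.  Object-search cell `pub-symmetroid`, door-A seat `val-sym-door-p3` (g23); a PARTIAL-RANGE row `--supports` the
route item `Theses.LacunarySymmetroid.DoorA34` (stmt-ValiantsHypothesis-19980, `DoorA34 = PosRootLawAt 3 4 18`), which is OPEN and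
asserted nowhere in this file.  The cell's structural charts of a `(3,4)` pencil (hollow corner, node forms, the classes R4 / R2 / R0)
are charts of nets with FOUR LINEARLY INDEPENDENT letters; the degenerate nets (letters spanning a space of matrices of dimension `≤ 3`)
are their boundary strata («cones», `DOOR-A34-P3G9-REPORT` §5).  This file settles the smallest of them for EVERY support and EVERY
number of letters, with no symmetry hypothesis at all:

* `det_two_smul_fin_three` — `det (α·T₀ + β·T₁) = det T₀·α³ + tr(adj T₀·T₁)·α²β + tr(adj T₁·T₀)·αβ² + det T₁·β³` (`3 × 3`, any
  commutative ring);
* `eval_det_pencil_rankTwoNet` — on letters `S_l = a_l·T₀ + b_l·T₁` the determinant of the pencil `∑ X^{d_l} S_l` evaluates at `t` to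
  the binary cubic `φ(A(t), B(t))`, `A = ∑ a_l t^{d_l}`, `B = ∑ b_l t^{d_l}` (scalar evaluations by `Census.eval_nodePoly`);
* **`card_posRoots_le_of_rankTwoNet`** — for ANY `K`, ANY exponents `d : Fin K → ℕ` and ANY real `3 × 3` matrices `T₀, T₁`, a pencil whose
  letters lie in `span{T₀, T₁}` has at most `3·(K − 1)` distinct positive det-roots: every positive root is a root of one of at most three
  `K`-nomials `A − u·B`, `u` a real root of the cubic `φ(u,1)` (after a shear making `det T₀ ≠ 0`), and a `K`-nomial has `≤ K − 1`
  positive roots (`Census.card_posRoots_borderNomial_le`);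
* `doorA34_ineq_on_rankTwoNet` — at `K = 4`: `≤ 9 ≤ 18`, i.e. `DoorA34`'s inequality holds with margin on the rank-`≤ 2` stratum of EVERY
  support (the rank-`3` stratum — cones over plane cubics composed with a planar `4`-nomial curve — is NOT bounded here and is where the
  seat's kit job «isocone-1» locates maxima).

Nothing here bounds `ζ_sym(3,4)` beyond this stratum; `DoorA34`, the strata stubs and `MatrixDescartes` (stmt-ValiantsHypothesis-18050)
stay OPEN; nothing bears on `VP ≠ VNP`.  [folklore] Binary cubic forms have at most three real projective zeros + the sparse Descartes
rule; elementary, no citation needed.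
-/

-- `Summit.ValiantsHypothesis.ValiantsHypothesis.…` repeats a component by the D-0017 layout
-- (single-conjunct summit), which the `dupNamespace` linter flags; the name is mandated.
set_option linter.dupNamespace false

namespace Summit.ValiantsHypothesis.ValiantsHypothesis.Theorems.LacunarySymmetroidMatrixDescartes.Census

open Polynomial Finset
open scoped BigOperators Polynomial Matrix
open Summit.ValiantsHypothesis.ValiantsHypothesis.Theorems.MatrixDescartes.Negative (PosRootLawAt)
open Summit.ValiantsHypothesis.ValiantsHypothesis.Theorems.SymmetroidDescartes (eval_det_pencil)

namespace RankTwoNet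

/-! ## The binary cubic of a two-dimensional net -/

/-- `3 × 3` expansion in two scalars over any commutative ring:
`det (α·T₀ + β·T₁) = det T₀·α³ + tr(adj T₀·T₁)·α²β + tr(adj T₁·T₀)·αβ² + det T₁·β³`. [folklore] -/
theorem det_two_smul_fin_three {R : Type*} [CommRing R] (T₀ T₁ : Matrix (Fin 3) (Fin 3) R) (α β : R) :
    (α • T₀ + β • T₁).det = T₀.det * α ^ 3 + (T₀.adjugate * T₁).trace * α ^ 2 * β
      + (T₁.adjugate * T₀).trace * α * β ^ 2 + T₁.det * β ^ 3 := by
  simp only [Matrix.det_fin_three, Matrix.adjugate_fin_three, Matrix.trace_fin_three, Matrix.mul_apply,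
    Fin.sum_univ_three, Matrix.add_apply, Matrix.smul_apply, smul_eq_mul, Matrix.of_apply, Matrix.cons_val',
    Matrix.cons_val_zero, Matrix.cons_val_one, Matrix.cons_val_two, Matrix.empty_val', Matrix.cons_val_fin_one,
    Matrix.head_cons, Matrix.tail_cons, Matrix.head_fin_const]
  ring

/-- The letters of a rank-two net evaluate to `A(t)·T₀ + B(t)·T₁`. [folklore] -/
theorem sum_smul_rankTwoNet {K : ℕ} (d : Fin K → ℕ) (T₀ T₁ : Matrix (Fin 3) (Fin 3) ℝ) (a b : Fin K → ℝ) (t : ℝ) :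
    (∑ l, t ^ d l • (a l • T₀ + b l • T₁)) = (∑ l, a l * t ^ d l) • T₀ + (∑ l, b l * t ^ d l) • T₁ := by
  simp only [smul_add, smul_smul, Finset.sum_add_distrib, Finset.sum_smul]
  congr 1 <;> exact Finset.sum_congr rfl fun l _ => by rw [mul_comm]

/-- **Evaluation of the determinant of a rank-two net**: with `A(t) = ∑ a_l t^{d_l}`, `B(t) = ∑ b_l t^{d_l}`,
`det(∑ t^{d_l} S_l) = det T₀·A³ + tr(adj T₀·T₁)·A²B + tr(adj T₁·T₀)·AB² + det T₁·B³`. [folklore] -/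
theorem eval_det_pencil_rankTwoNet {K : ℕ} (d : Fin K → ℕ) (T₀ T₁ : Matrix (Fin 3) (Fin 3) ℝ) (a b : Fin K → ℝ) (t : ℝ) :
    ((∑ l, (X : ℝ[X]) ^ d l • (a l • T₀ + b l • T₁).map C).det).eval t
      = T₀.det * (∑ l, a l * t ^ d l) ^ 3 + (T₀.adjugate * T₁).trace * (∑ l, a l * t ^ d l) ^ 2 * (∑ l, b l * t ^ d l)
        + (T₁.adjugate * T₀).trace * (∑ l, a l * t ^ d l) * (∑ l, b l * t ^ d l) ^ 2 + T₁.det * (∑ l, b l * t ^ d l) ^ 3 := by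
  rw [eval_det_pencil, sum_smul_rankTwoNet, det_two_smul_fin_three]

/-- The difference `A − u·B` of two `K`-nomials on `d` is the `K`-nomial with coefficients `a_l − u·b_l`. [folklore] -/
theorem nomial_sub_smul {K : ℕ} (d : Fin K → ℕ) (a b : Fin K → ℝ) (u : ℝ) :
    (∑ l, C (a l) * (X : ℝ[X]) ^ d l) - C u * (∑ l, C (b l) * (X : ℝ[X]) ^ d l)
      = ∑ l, C (a l - u * b l) * (X : ℝ[X]) ^ d l := by
  rw [Finset.mul_sum, ← Finset.sum_sub_distrib]
  exact Finset.sum_congr rfl fun l _ => by rw [map_sub, map_mul]; ring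

/-- A real polynomial vanishing at every positive real is the zero polynomial. [folklore] -/
theorem eq_zero_of_forall_pos_isRoot (P : ℝ[X]) (h : ∀ t : ℝ, 0 < t → P.IsRoot t) : P = 0 := by
  apply Polynomial.eq_zero_of_infinite_isRoot
  apply Set.infinite_of_not_bddAbove
  intro hb
  obtain ⟨M, hM⟩ := hb
  have h1 : max M 0 + 1 ∈ {x | P.IsRoot x} := h _ (by have := le_max_right M 0; linarith)
  have h2 := hM h1
  have := le_max_left M 0
  linarith

/-! ## The core count: `det T₀ ≠ 0` -/

/-- **Core count** (`det T₀ ≠ 0`).  Every positive det-root `t` of the pencil on letters `a_l·T₀ + b_l·T₁` is a root of the `K`-nomial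
`A − u·B` for some real root `u` of the cubic `ψ(u) = det T₀·u³ + tr(adj T₀·T₁)·u² + tr(adj T₁·T₀)·u + det T₁` (if `B(t) ≠ 0` take
`u = A(t)/B(t)`; if `B(t) = 0` then `A(t) = 0` and any real root of `ψ` — one exists — will do); `ψ` has at most three real roots and
each `A − u·B` is a non-zero `K`-nomial (else the determinant vanishes identically), whence `≤ 3·(K − 1)`. [folklore] -/
theorem card_posRoots_le_of_rankTwoNet_of_det_ne_zero {K : ℕ} (d : Fin K → ℕ) (T₀ T₁ : Matrix (Fin 3) (Fin 3) ℝ)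
    (a b : Fin K → ℝ) (h0 : T₀.det ≠ 0) :
    (((∑ l, (X : ℝ[X]) ^ d l • (a l • T₀ + b l • T₁).map C).det).roots.toFinset.filter (fun t => 0 < t)).card
      ≤ 3 * (K - 1) := by
  classical
  set P : ℝ[X] := (∑ l, (X : ℝ[X]) ^ d l • (a l • T₀ + b l • T₁).map C).det with hPdef
  by_cases hP : P = 0
  · rw [hP, Polynomial.roots_zero, Multiset.toFinset_zero, Finset.filter_empty, Finset.card_empty]
    exact Nat.zero_le _
  set c₀ := T₀.det with hc₀
  set c₁ := (T₀.adjugate * T₁).trace with hc₁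
  set c₂ := (T₁.adjugate * T₀).trace with hc₂
  set c₃ := T₁.det with hc₃
  set A : ℝ[X] := ∑ l, C (a l) * (X : ℝ[X]) ^ d l with hA
  set B : ℝ[X] := ∑ l, C (b l) * (X : ℝ[X]) ^ d l with hB
  set ψ : ℝ[X] := C c₀ * X ^ 3 + C c₁ * X ^ 2 + C c₂ * X + C c₃ with hψ
  have hψeval : ∀ u : ℝ, ψ.eval u = c₀ * u ^ 3 + c₁ * u ^ 2 + c₂ * u + c₃ := fun u => by
    simp only [hψ, eval_add, eval_mul, eval_C, eval_pow, eval_X]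
  have hψ0 : ψ ≠ 0 := by
    intro h
    have hc : ψ.coeff 3 = c₀ := by
      simp only [hψ, coeff_add, coeff_C_mul, coeff_X_pow, coeff_X, coeff_C]
      norm_num
    rw [h, coeff_zero] at hc
    exact h0 hc.symm
  set R : Finset ℝ := ψ.roots.toFinset with hR
  have hRcard : R.card ≤ 3 :=
    (Multiset.toFinset_card_le _).trans ((Polynomial.card_roots' ψ).trans (by
      rw [hψ]; exact Polynomial.natDegree_cubic_le))
  have hRmem : ∀ u : ℝ, u ∈ R ↔ c₀ * u ^ 3 + c₁ * u ^ 2 + c₂ * u + c₃ = 0 := fun u => by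
    rw [hR, Multiset.mem_toFinset, Polynomial.mem_roots hψ0, Polynomial.IsRoot.def, hψeval]
  have hRne : R.Nonempty := by
    obtain ⟨u, hu⟩ := EqualDiagonal.exists_root_cubic c₃ c₂ c₁ c₀ h0
    exact ⟨u, (hRmem u).mpr hu⟩
  -- evaluation of `P`
  have hevalP : ∀ t : ℝ, P.eval t = c₀ * (A.eval t) ^ 3 + c₁ * (A.eval t) ^ 2 * (B.eval t)
      + c₂ * (A.eval t) * (B.eval t) ^ 2 + c₃ * (B.eval t) ^ 3 := fun t => by
    rw [hPdef, eval_det_pencil_rankTwoNet, hA, hB, eval_nodePoly, eval_nodePoly]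
  -- the pieces `A − u·B` are non-zero
  have hpiece : ∀ u ∈ R, A - C u * B ≠ 0 := by
    intro u hu hzero
    have hu' := (hRmem u).mp hu
    apply hP
    apply eq_zero_of_forall_pos_isRoot
    intro t _
    have hAB : A.eval t = u * B.eval t := by
      have := congrArg (fun p : ℝ[X] => p.eval t) hzero
      simp only [eval_sub, eval_mul, eval_C, eval_zero] at this
      linarith
    rw [Polynomial.IsRoot.def, hevalP t, hAB]
    have : c₀ * (u * B.eval t) ^ 3 + c₁ * (u * B.eval t) ^ 2 * B.eval t + c₂ * (u * B.eval t) * B.eval t ^ 2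
        + c₃ * B.eval t ^ 3 = (c₀ * u ^ 3 + c₁ * u ^ 2 + c₂ * u + c₃) * B.eval t ^ 3 := by ring
    rw [this, hu', zero_mul]
  -- cover
  have hcover : (P.roots.toFinset.filter (fun t => 0 < t))
      ⊆ R.biUnion (fun u => ((A - C u * B).roots.toFinset.filter (fun t => 0 < t))) := by
    intro t ht
    rw [Finset.mem_filter, Multiset.mem_toFinset, Polynomial.mem_roots hP, Polynomial.IsRoot.def, hevalP] at ht
    obtain ⟨hroot, hpos⟩ := ht
    rw [Finset.mem_biUnion]
    by_cases hβ : B.eval t = 0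
    · -- then `A(t) = 0` too, and any real root of `ψ` works
      have hα3 : c₀ * (A.eval t) ^ 3 = 0 := by rw [hβ] at hroot; linarith [hroot]
      have hα : A.eval t = 0 := by
        rcases mul_eq_zero.mp hα3 with h | h
        · exact absurd h h0
        · exact pow_eq_zero_iff (by norm_num) |>.mp h
      obtain ⟨u, hu⟩ := hRne
      refine ⟨u, hu, ?_⟩
      rw [Finset.mem_filter, Multiset.mem_toFinset, Polynomial.mem_roots (hpiece u hu), Polynomial.IsRoot.def,
        eval_sub, eval_mul, eval_C, hα, hβ]
      exact ⟨by ring, hpos⟩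
    · set u := A.eval t / B.eval t with hu
      have huR : u ∈ R := by
        rw [hRmem]
        have hAu : A.eval t = u * B.eval t := by rw [hu]; field_simp
        rw [hAu] at hroot
        have : (c₀ * u ^ 3 + c₁ * u ^ 2 + c₂ * u + c₃) * (B.eval t) ^ 3 = 0 := by linear_combination hroot
        rcases mul_eq_zero.mp this with h | h
        · exact h
        · exact absurd (pow_eq_zero_iff (by norm_num) |>.mp h) hβ
      refine ⟨u, huR, ?_⟩
      rw [Finset.mem_filter, Multiset.mem_toFinset, Polynomial.mem_roots (hpiece u huR), Polynomial.IsRoot.def,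
        eval_sub, eval_mul, eval_C, hu]
      exact ⟨by rw [div_mul_cancel₀ _ hβ, sub_self], hpos⟩
  -- count
  have hpiececard : ∀ u ∈ R, (((A - C u * B).roots.toFinset.filter (fun t => 0 < t))).card ≤ K - 1 := by
    intro u hu
    have h := hpiece u hu
    rw [hA, hB, nomial_sub_smul] at h ⊢
    exact card_posRoots_borderNomial_le d _ h
  calc (P.roots.toFinset.filter (fun t => 0 < t)).card
      ≤ (R.biUnion (fun u => ((A - C u * B).roots.toFinset.filter (fun t => 0 < t)))).card := Finset.card_le_card hcover
    _ ≤ ∑ u ∈ R, (((A - C u * B).roots.toFinset.filter (fun t => 0 < t))).card := Finset.card_biUnion_le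
    _ ≤ R.card * (K - 1) := by
        have := Finset.sum_le_card_nsmul R _ (K - 1) hpiececard
        simpa using this
    _ ≤ 3 * (K - 1) := Nat.mul_le_mul_right _ hRcard

/-! ## The shear to `det T₀ ≠ 0`, and the count for every rank-two net -/

/-- Among `0, 1, 2, 3` some `μ` is not a root of a non-zero real polynomial of degree `≤ 3`. [folklore] -/
theorem exists_nonroot_of_cubic (q : ℝ[X]) (hq : q ≠ 0) (hdeg : q.natDegree ≤ 3) :
    ∃ μ : ℝ, q.eval μ ≠ 0 := by
  classical
  by_contra h
  push Not at h
  have hsub : ({0, 1, 2, 3} : Finset ℝ) ⊆ q.roots.toFinset := by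
    intro μ _
    rw [Multiset.mem_toFinset, Polynomial.mem_roots hq]
    exact h μ
  have h4 : ({0, 1, 2, 3} : Finset ℝ).card = 4 := by norm_num
  have := (Finset.card_le_card hsub).trans ((Multiset.toFinset_card_le _).trans ((Polynomial.card_roots' q).trans hdeg))
  omega

/-- **THE RANK-TWO NET COUNT (every `K`, every support, any real `3 × 3` matrices).**  If the letters of the pencil `∑ₗ X^{d_l} S_l` lie
in the span of two matrices, `S_l = a_l·T₀ + b_l·T₁`, then its determinant has at most `3·(K − 1)` distinct positive roots — the count
of three scalar `K`-nomials.  (If the binary cubic `det(s·T₀ + t·T₁)` vanishes identically the determinant is the zero polynomial and no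
root is counted; otherwise a shear `T₀ ↦ T₀ + μ·T₁`, `b ↦ b − μ·a` makes `det T₀ ≠ 0` and the core count applies.) [folklore] -/
theorem card_posRoots_le_of_rankTwoNet {K : ℕ} (d : Fin K → ℕ) (T₀ T₁ : Matrix (Fin 3) (Fin 3) ℝ) (a b : Fin K → ℝ) :
    (((∑ l, (X : ℝ[X]) ^ d l • (a l • T₀ + b l • T₁).map C).det).roots.toFinset.filter (fun t => 0 < t)).card
      ≤ 3 * (K - 1) := by
  classical
  set c₀ := T₀.det with hc₀
  set c₁ := (T₀.adjugate * T₁).trace with hc₁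
  set c₂ := (T₁.adjugate * T₀).trace with hc₂
  set c₃ := T₁.det with hc₃
  -- the cubic `μ ↦ det (T₀ + μ T₁)`
  set q : ℝ[X] := C c₃ * X ^ 3 + C c₂ * X ^ 2 + C c₁ * X + C c₀ with hq
  have hqeval : ∀ μ : ℝ, q.eval μ = (T₀ + μ • T₁).det := fun μ => by
    have h := det_two_smul_fin_three T₀ T₁ (1 : ℝ) μ
    rw [one_smul] at h
    rw [h]
    simp only [hq, eval_add, eval_mul, eval_C, eval_pow, eval_X]
    ring
  by_cases hq0 : q = 0
  · -- all four coefficients vanish: the determinant is identically zero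
    have hcoef : c₀ = 0 ∧ c₁ = 0 ∧ c₂ = 0 ∧ c₃ = 0 := by
      have e0 : q.coeff 0 = c₀ := by
        simp only [hq, coeff_add, coeff_C_mul, coeff_X_pow, coeff_X, coeff_C]; norm_num
      have e1 : q.coeff 1 = c₁ := by
        simp only [hq, coeff_add, coeff_C_mul, coeff_X_pow, coeff_X, coeff_C]; norm_num
      have e2 : q.coeff 2 = c₂ := by
        simp only [hq, coeff_add, coeff_C_mul, coeff_X_pow, coeff_X, coeff_C]; norm_num
      have e3 : q.coeff 3 = c₃ := by
        simp only [hq, coeff_add, coeff_C_mul, coeff_X_pow, coeff_X, coeff_C]; norm_num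
      rw [hq0, coeff_zero] at e0 e1 e2 e3
      exact ⟨e0.symm, e1.symm, e2.symm, e3.symm⟩
    have hP : (∑ l, (X : ℝ[X]) ^ d l • (a l • T₀ + b l • T₁).map C).det = 0 := by
      apply eq_zero_of_forall_pos_isRoot
      intro t _
      rw [Polynomial.IsRoot.def, eval_det_pencil_rankTwoNet, ← hc₀, ← hc₁, ← hc₂, ← hc₃, hcoef.1, hcoef.2.1, hcoef.2.2.1,
        hcoef.2.2.2]
      ring
    rw [hP, Polynomial.roots_zero, Multiset.toFinset_zero, Finset.filter_empty, Finset.card_empty]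
    exact Nat.zero_le _
  · obtain ⟨μ, hμ⟩ := exists_nonroot_of_cubic q hq0 (by rw [hq]; exact Polynomial.natDegree_cubic_le)
    rw [hqeval] at hμ
    -- shear: `a_l·T₀ + b_l·T₁ = a_l·(T₀ + μ T₁) + (b_l − μ a_l)·T₁`
    have hshear : (fun l => a l • T₀ + b l • T₁) = fun l => a l • (T₀ + μ • T₁) + (b l - μ * a l) • T₁ := by
      funext l
      rw [smul_add, smul_smul, sub_smul, mul_comm μ (a l)]
      abel
    have key := card_posRoots_le_of_rankTwoNet_of_det_ne_zero d (T₀ + μ • T₁) T₁ a (fun l => b l - μ * a l) hμ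
    have hsum : (∑ l, (X : ℝ[X]) ^ d l • (a l • T₀ + b l • T₁).map C)
        = ∑ l, (X : ℝ[X]) ^ d l • (a l • (T₀ + μ • T₁) + (b l - μ * a l) • T₁).map C :=
      Finset.sum_congr rfl fun l _ => by rw [show a l • T₀ + b l • T₁ = a l • (T₀ + μ • T₁) + (b l - μ * a l) • T₁ from
        congrFun hshear l]
    rw [hsum]
    exact key

/-! ## Door A on the rank-two stratum -/

/-- **`DoorA34`'s inequality with margin on the RANK-TWO NET stratum (all supports).**  A four-letter `3 × 3` pencil (the letters need
not even be symmetric) whose letters span a space of matrices of dimension `≤ 2` has at most `9` distinct positive det-roots. [folklore] -/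
theorem card_posRoots_le_nine_of_rankTwoNet (d : Fin 4 → ℕ) (S : Fin 4 → Matrix (Fin 3) (Fin 3) ℝ)
    (T₀ T₁ : Matrix (Fin 3) (Fin 3) ℝ) (a b : Fin 4 → ℝ) (hS : ∀ l, S l = a l • T₀ + b l • T₁) :
    (((∑ l, (X : ℝ[X]) ^ d l • (S l).map C).det).roots.toFinset.filter (fun t => 0 < t)).card ≤ 9 := by
  have h := card_posRoots_le_of_rankTwoNet d T₀ T₁ a b
  have hS' : (fun l => S l) = fun l => a l • T₀ + b l • T₁ := funext hS
  have hsum : (∑ l, (X : ℝ[X]) ^ d l • (S l).map C) = ∑ l, (X : ℝ[X]) ^ d l • (a l • T₀ + b l • T₁).map C :=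
    Finset.sum_congr rfl fun l _ => by rw [hS l]
  rw [hsum]
  exact h.trans (by norm_num)

/-- Hence the door's `≤ 18` on that stratum, for every support `d`. [folklore] -/
theorem doorA34_ineq_on_rankTwoNet (d : Fin 4 → ℕ) (S : Fin 4 → Matrix (Fin 3) (Fin 3) ℝ)
    (T₀ T₁ : Matrix (Fin 3) (Fin 3) ℝ) (a b : Fin 4 → ℝ) (hS : ∀ l, S l = a l • T₀ + b l • T₁) :
    (((∑ l, (X : ℝ[X]) ^ d l • (S l).map C).det).roots.toFinset.filter (fun t => 0 < t)).card ≤ 18 :=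
  (card_posRoots_le_nine_of_rankTwoNet d S T₀ T₁ a b hS).trans (by norm_num)

/-- The one-dimensional net (all letters multiples of one matrix `T`): at most `K − 1 ≤ 3·(K − 1)` — here recorded as the instance
`T₁ = 0` of the rank-two count, `≤ 3·(K − 1)`. [folklore] -/
theorem card_posRoots_le_of_rankOneNet {K : ℕ} (d : Fin K → ℕ) (T : Matrix (Fin 3) (Fin 3) ℝ) (a : Fin K → ℝ) :
    (((∑ l, (X : ℝ[X]) ^ d l • (a l • T).map C).det).roots.toFinset.filter (fun t => 0 < t)).card ≤ 3 * (K - 1) := by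
  have h := card_posRoots_le_of_rankTwoNet d T 0 a (fun _ => 0)
  have hsum : (∑ l, (X : ℝ[X]) ^ d l • (a l • T).map C)
      = ∑ l, (X : ℝ[X]) ^ d l • (a l • T + (fun _ => (0 : ℝ)) l • (0 : Matrix (Fin 3) (Fin 3) ℝ)).map C :=
    Finset.sum_congr rfl fun l _ => by rw [smul_zero, add_zero]
  rw [hsum]
  exact h

end RankTwoNet

end Summit.ValiantsHypothesis.ValiantsHypothesis.Theorems.LacunarySymmetroidMatrixDescartes.Census
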